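import Mathlib
import Literature.Geometry.Lorentzian.ReggeWheelerTortoise
import Literature.Geometry.Lorentzian.ReggeWheelerChannels
import Literature.Analysis.PDE.Wave1DSpatialReflection
import Summits.FinalStateConjecture.FinalStateConjecture.Theorems.PhotonSphereChannelsUniformPhotonSphereChannelsRLadderExists
import Summits.FinalStateConjecture.FinalStateConjecture.Theorems.PhotonSphereChannelsUniformPhotonSphereChannelsRPeel
import Summits.FinalStateConjecture.FinalStateConjecture.Theorems.PhotonSphereChannelsUniformPhotonSphereChannelsRKernelOneChannelsNoMoment
import Summits.FinalStateConjecture.FinalStateConjecture.Theorems.PhotonSphereChannelsUniformRResidual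
import Summits.FinalStateConjecture.FinalStateConjecture.Theorems.PhotonSphereChannelsUniformRNearFar

/-!
# Crux `UniformPhotonSphereChannelsR` (K1R, stmt-FinalStateConjecture-14074), line
# `crum-peeling-recessive-tower` — closing chain 2/3: the uniform FAR log-edge channel inequality,
# GIVEN the coefficient majorant

The open content of K1R is its far (null-infinity-side) half: for `ρ ≥ ρ₀(M) + C(M) log(ℓ+1)` and
every global Regge–Wheeler solution `ψ`,
`(1/2) · inf_{p ∈ P_far(ρ)} E_{x > xc+ρ}[ψ − p](0) ≤ liminf_{+∞} E_far + liminf_{−∞} E_far`,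
`P_far` the `t`-polynomial `C²` solutions on the far cone.  Following the line's skeleton v4 §3
(`farLogEdgeChannels_of`, lead-0; verbatim up to the threading of the hypothesis): take the recessive
Riccati–Crum ladder of `V_{s,ℓ}` (`stub_ladderExists`, landed), its sub-Hardy residual
(`residualSubHardy_of_coeffMajorant hA`, closing chain 1/3), peel along the ladder (`stub_peel`,
landed) and close with the kernel-one channel inequality (`stub_kernelOneChannelsNoMoment`, landed);
infinite far energy is trivial (`wave1D_farEnergy_eq_top_of_initial_eq_top`).  The only hypothesis is
the registered statement of `stub_coeffMajorant` (Theorem A), verbatim.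
-/

-- `Summit.<S>.<S>` repeats a namespace component by design (D-0017); off here as in the lakefile.
set_option linter.dupNamespace false

noncomputable section

namespace Summit.FinalStateConjecture.FinalStateConjecture.Theorems.UniformRClosing

open Literature.Geometry.Lorentzian Literature.Geometry.Lorentzian.ReggeWheeler
open Summit.FinalStateConjecture.FinalStateConjecture.Theorems
open Literature.Analysis.PDE
open MeasureTheory Filter Set Topology
open scoped ENNReal

/-- **The uniform far half of K1R, given the coefficient majorant** (`ρ₀ = max ρ₁ ρ₂`,
`C = max C₁ C₂`, `c = 1/2`): ladder (E, landed), sub-Hardy residual (R, from `hA`), peel (P, landed),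
kernel-one channels (K, landed); the conclusion is the skeleton's `FarLogEdgeChannels`, spelled out. -/
theorem farLogEdgeChannels_of_coeffMajorant
    (hA : ∃ K : ℝ, 1 ≤ K ∧ ∀ (s ℓ : ℕ), s ≤ 2 → s ≤ ℓ → 1 ≤ ℓ → ∀ (Ω G : ℕ → ℕ → ℝ), (∀ k, Ω k 0 = 1) →
      (∀ k, G k 0 = 1) →
      (∀ k n, ∑ i ∈ Finset.range (n + 1), G k i * Ω k (n - i) = if n = 0 then 1 else 0) →
      (∀ n, (ℓ : ℝ) ^ 2 * ∑ i ∈ Finset.range (n + 1), Ω 0 i * Ω 0 (n - i) + (ℓ : ℝ) * (((n : ℝ) +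
      1) * Ω 0 n - 2 * (n : ℝ) * Ω 0 (n - 1)) = (if n = 0 then (ℓ : ℝ) * ((ℓ : ℝ) + 1) else if n =
      1 then 2 * (1 - (s : ℝ) ^ 2) - 2 * ((ℓ : ℝ) * ((ℓ : ℝ) + 1)) else if n = 2 then -(4 * (1 - (s
      : ℝ) ^ 2)) else 0)) →
      (∀ k, k + 2 ≤ ℓ →
      ∀ n, ((ℓ : ℝ) - k - 1) ^ 2 * ∑ i ∈ Finset.range (n + 1), Ω (k + 1) i * Ω (k + 1) (n - i) +
      ((ℓ : ℝ) - k - 1) * (((n : ℝ) + 1) * Ω (k + 1) n - 2 * (n : ℝ) * Ω (k + 1) (n - 1)) = ((ℓ :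
      ℝ) - k) ^ 2 * ∑ i ∈ Finset.range (n + 1), Ω k i * Ω k (n - i) - ((ℓ : ℝ) - k) * (((n : ℝ) +
      1) * Ω k n - 2 * (n : ℝ) * Ω k (n - 1))) →
      ∀ k, k + 1 ≤ ℓ → |G k 1| ≤ K * (1 + Real.log ((ℓ : ℝ) + 1)) ∧ (∀ n, 2 ≤ n →
      |G k n| ≤ (K * (1 + Real.log ((ℓ : ℝ) + 1))) ^ (n - 1)) ∧
      (∀ n, |Ω k n| ≤ (K * (1 + Real.log ((ℓ : ℝ) + 1))) ^ n)) :
    ∀ M : ℝ, 0 < M → ∃ ρ₀ : ℝ, 0 ≤ ρ₀ ∧ ∃ C : ℝ, 0 ≤ C ∧ ∃ c : ℝ, 0 < c ∧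
      ∀ (r : ℝ → ℝ) (xc : ℝ), IsTortoiseRadius M r xc → ∀ (s ℓ : ℕ), s ≤ 2 → s ≤ ℓ →
        ∀ ρ : ℝ, ρ₀ + C * Real.log ((ℓ : ℝ) + 1) ≤ ρ →
          ∀ ψ : ℝ → ℝ → ℝ, IsRWSolution M s ℓ r ψ →
            ENNReal.ofReal c *
                (⨅ p ∈ {p : ℝ → ℝ → ℝ |
                    IsSolutionOn (linePotential M s ℓ r) p {z : ℝ × ℝ | xc + ρ + |z.1| < z.2} ∧
                      IsPolynomialInTimeOn p {z : ℝ × ℝ | xc + ρ + |z.1| < z.2}},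
                  ∫⁻ x in Set.Ioi (xc + ρ), ENNReal.ofReal
                    (energyDensity (linePotential M s ℓ r) (fun t y => ψ t y - p t y) 0 x))
              ≤ farChannelEnergy (linePotential M s ℓ r) (xc + ρ) ψ atTop
                + farChannelEnergy (linePotential M s ℓ r) (xc + ρ) ψ atBot := by
  intro M hM
  obtain ⟨ρ₁, hρ₁, C₁, hC₁, HE⟩ := CrumPeelingRecessiveTower.stub_ladderExists M hM
  obtain ⟨ρ₂, hρ₂, C₂, hC₂, HR⟩ := residualSubHardy_of_coeffMajorant hA M hM
  refine ⟨max ρ₁ ρ₂, hρ₁.trans (le_max_left _ _), max C₁ C₂, hC₁.trans (le_max_left _ _),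
    1 / 2, by norm_num, ?_⟩
  intro r xc hr s ℓ hs hsℓ ρ hρ ψ hψ
  have hρE : ρ₁ + C₁ * Real.log ((ℓ : ℝ) + 1) ≤ ρ :=
    threshold_mono' (le_max_left _ _) (le_max_left _ _) hρ
  have hρR : ρ₂ + C₂ * Real.log ((ℓ : ℝ) + 1) ≤ ρ :=
    threshold_mono' (le_max_right _ _) (le_max_right _ _) hρ
  set V : ℝ → ℝ := linePotential M s ℓ r with hVdef
  set xf : ℝ := xc + ρ with hxf
  -- the potential
  have hVc : Continuous V := continuous_linePotential s ℓ hr.continuous fun x => (hr.pos x).ne'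
  have hV0 : ∀ x, 0 ≤ V x := linePotential_nonneg hr.mass_pos.le hsℓ hr.two_mul_lt
  have hψ2 : ContDiff ℝ 2 (Function.uncurry ψ) := hψ.1
  have hsol : ∀ t x, iteratedDeriv 2 (fun τ => ψ τ x) t - iteratedDeriv 2 (ψ t) x
      + V x * ψ t x = 0 := fun t x => hψ.2 (t, x)
  by_cases htop : farEnergy V xf ψ 0 = ⊤
  · -- infinite far energy persists: the right-hand side is `⊤`
    have htop' : (∫⁻ x in Set.Ioi xf, ENNReal.ofReal
        (deriv (fun τ => ψ τ x) 0 ^ 2 + deriv (ψ 0) x ^ 2 + V x * ψ 0 x ^ 2)) = ⊤ := by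
      have h := htop
      change (∫⁻ x in Set.Ioi (xf + |(0 : ℝ)|), ENNReal.ofReal
        (deriv (fun τ => ψ τ x) 0 ^ 2 + deriv (ψ 0) x ^ 2 + V x * ψ 0 x ^ 2)) = ⊤ at h
      rwa [abs_zero, add_zero] at h
    have hall : ∀ t, farEnergy V xf ψ t = ⊤ := fun t =>
      wave1D_farEnergy_eq_top_of_initial_eq_top hVc hV0 hψ2 hsol htop' t
    have hfun : farEnergy V xf ψ = fun _ => ⊤ := funext hall
    have h1 : farChannelEnergy V xf ψ atTop = ⊤ := by
      unfold farChannelEnergy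
      rw [hfun, liminf_const]
    rw [h1, top_add]
    exact le_top
  · -- finite far energy: ladder, residual bound, peel, close
    obtain ⟨W, U, a, ha, hL0, hL1, hL2, hL3, hQC1⟩ := HE r xc hr s ℓ hs hsℓ ρ hρE
    obtain ⟨⟨a', haa', ha', hQpos⟩, hanti, hsub⟩ :=
      HR r xc hr s ℓ hs hsℓ ρ hρR W U a ha hL0 hL1 hL2 hL3
    -- restrict the ladder to `(a', ∞)`
    have hL0' : ∀ x, a' < x → U 0 x = V x := fun x hx => hL0 x (lt_of_le_of_lt haa' hx)
    have hL1' : ∀ k, k < ℓ → ∀ x, a' < x → HasDerivAt (W k) (U k x - W k x ^ 2) x :=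
      fun k hk x hx => hL1 k hk x (lt_of_le_of_lt haa' hx)
    have hL2' : ∀ k, k < ℓ → ∀ x, a' < x → U (k + 1) x = 2 * W k x ^ 2 - U k x :=
      fun k hk x hx => hL2 k hk x (lt_of_le_of_lt haa' hx)
    have hQC1' : ContDiffOn ℝ 1 (U ℓ) (Set.Ioi a') := hQC1.mono (Set.Ioi_subset_Ioi haa')
    obtain ⟨φ, u, hφC2, hφsol, hφE, huC2, hueq, huE, hu0, hTop, hBot, hdef⟩ :=
      CrumPeelingRecessiveTower.stub_peel M r xc hr s ℓ hs hsℓ W U a' hL0' hL1' hL2' hL3 hQpos xf ha' ψ hψ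
        htop
    have hclose := CrumPeelingRecessiveTower.stub_kernelOneChannelsNoMoment (U ℓ) a' xf ha' hQC1'
      hQpos hanti hsub u huC2 hueq huE hu0 φ hφC2 hφsol hφE
    calc ENNReal.ofReal (1 / 2) *
          (⨅ p ∈ {p : ℝ → ℝ → ℝ |
              IsSolutionOn V p {z : ℝ × ℝ | xf + |z.1| < z.2} ∧
                IsPolynomialInTimeOn p {z : ℝ × ℝ | xf + |z.1| < z.2}},
            ∫⁻ x in Set.Ioi xf, ENNReal.ofReal (energyDensity V (fun t y => ψ t y - p t y) 0 x))
        ≤ ENNReal.ofReal (1 / 2) *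
            ⨅ c : ℝ, ∫⁻ x in Set.Ioi xf,
              ENNReal.ofReal (energyDensity (U ℓ) (fun t y => φ t y - c * u y) 0 x) := by
          gcongr
      _ ≤ farChannelEnergy (U ℓ) xf φ atTop + farChannelEnergy (U ℓ) xf φ atBot := hclose
      _ ≤ farChannelEnergy V xf ψ atTop + farChannelEnergy V xf ψ atBot := add_le_add hTop hBot

end Summit.FinalStateConjecture.FinalStateConjecture.Theorems.UniformRClosing
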